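import Summits.AtomisticToContinuum.FouriersLaw.Theorems.OddSectorIrreversibilityOddCorrectorDecayTransport

/-!
# The bath-locality estimate: generic tools for the expectation of the pointwise bound

Support file for item `stmt-AtomisticToContinuum-9139` (`OddSectorIrreversibility.OddCorrectorDecay`), negative
side. Small generic lemmas used by `Expectation.lean` to integrate the pointwise bound against
`μ_T ⊗ P`: time integrals of continuous nonnegative functions as Lebesgue integrals, Tonelli with a uniform
bound, and the bookkeeping of the explicit constants (plain real identities and their `ℝ≥0∞` casts, stated
over free variables so that no large definitions are unfolded by the normalisation tactics).
-/

noncomputable section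

open MeasureTheory Set Function intervalIntegral
open scoped NNReal ENNReal

namespace Summit.AtomisticToContinuum.FouriersLaw.Theorems.OddCorrectorBathLocality

/-! ### Two generic tools: time integrals as Lebesgue integrals, and Tonelli with a uniform bound -/

/-- For a continuous nonnegative integrand, `ofReal (∫₀ᵗ f) = ∫⁻_{(0,t]} ofReal f`. [folklore] -/
theorem ofReal_intervalIntegral_eq {f : ℝ → ℝ} (hf : Continuous f) (h0 : ∀ τ, 0 ≤ f τ) {t : ℝ} (ht : 0 ≤ t) :
    ENNReal.ofReal (∫ τ in (0:ℝ)..t, f τ) = ∫⁻ τ in Ioc 0 t, ENNReal.ofReal (f τ) := by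
  rw [intervalIntegral.integral_of_le ht, ofReal_integral_eq_lintegral_ofReal
    ((hf.integrableOn_Icc (a := 0) (b := t)).mono_set Ioc_subset_Icc_self) (ae_of_all _ fun τ => h0 τ)]

/-- **Tonelli with a uniform bound**: if `F : ℝ × α → ℝ≥0∞` is jointly measurable and
`∫ F(τ, ·) dν ≤ B` for `τ ∈ (0, t]`, then `∫ (∫⁻_{(0,t]} F(τ,a) dτ) dν(a) ≤ B · t`; and the inner integral is a
measurable function of `a`. [folklore] -/
theorem lintegral_setLIntegral_le {α : Type*} [MeasurableSpace α] {ν : Measure α} [SFinite ν]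
    {F : ℝ × α → ℝ≥0∞} (hF : Measurable F) {t : ℝ} {B : ℝ≥0∞}
    (hB : ∀ τ ∈ Ioc (0:ℝ) t, ∫⁻ a, F (τ, a) ∂ν ≤ B) :
    (Measurable fun a => ∫⁻ τ in Ioc 0 t, F (τ, a)) ∧
      ∫⁻ a, (∫⁻ τ in Ioc 0 t, F (τ, a)) ∂ν ≤ B * ENNReal.ofReal t := by
  have hswap : Measurable fun q : α × ℝ => F (q.2, q.1) := hF.comp measurable_swap
  refine ⟨hswap.lintegral_prod_right', ?_⟩
  have hae : AEMeasurable (uncurry fun (a : α) (τ : ℝ) => F (τ, a)) (ν.prod (volume.restrict (Ioc 0 t))) :=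
    hswap.aemeasurable
  rw [lintegral_lintegral_swap hae]
  calc ∫⁻ τ in Ioc 0 t, ∫⁻ a, F (τ, a) ∂ν ≤ ∫⁻ _τ in Ioc 0 t, B := setLIntegral_mono' measurableSet_Ioc hB
    _ = B * ENNReal.ofReal t := by rw [setLIntegral_const, Real.volume_Ioc, sub_zero]

/-! ### Bookkeeping of constants (plain real and `ℝ≥0∞` identities) -/

/-- Rearrangement of the pointwise bound into five products. [folklore] -/
theorem pointwise_coeff_rearrange (s t Ψ₁ Ψ₂ I₂ b I₄ I₅ a₁ a₂ a₃ : ℝ) (hs : s ≠ 0) (ht : t ≠ 0) :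
    (s ^ 3 * (1216 * (Ψ₁ + Ψ₂)) + s ^ 3 * (t⁻¹ * I₂) + (a₁ * b + a₂ * I₄ + a₃ * I₅) / s ^ 6) / 3 =
      (s ^ 3 * 1216 / 3) * (Ψ₁ + Ψ₂) + (s ^ 3 * t⁻¹ / 3) * I₂ + (a₁ / (3 * s ^ 6)) * b +
        (a₂ / (3 * s ^ 6)) * I₄ + (a₃ / (3 * s ^ 6)) * I₅ := by
  field_simp
  ring

/-- The two `Ψ`-coefficients add up to `s³ A₁`. [folklore] -/
theorem psi_coeff_sum (s t e : ℝ) (ht : t ≠ 0) :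
    s ^ 3 * 1216 / 3 * 2 + s ^ 3 * t⁻¹ / 3 * (e * 2 * t) = s ^ 3 * ((2 * 1216 + 2 * e) / 3) := by
  field_simp

/-- The three `Z`-coefficients add up to at most `A₂ / s⁶`. [folklore] -/
theorem z_coeff_sum_le {s t t₀ c m k γ : ℝ} (hs : 0 < s) (ht : 0 ≤ t) (htt : t ≤ t₀) (hm : 0 ≤ m) (hk : 0 ≤ k) :
    32768 * c ^ 6 / (3 * s ^ 6) * m + 32768 * t₀ ^ 5 * c ^ 6 / (3 * s ^ 6) * (m * t) +
        1048576 * γ ^ 6 * t₀ ^ 5 * (1 + t₀ ^ 6) / (3 * s ^ 6) * (k * t) ≤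
      (32768 * c ^ 6 * m + 32768 * t₀ ^ 5 * c ^ 6 * (m * t₀) +
        1048576 * γ ^ 6 * t₀ ^ 5 * (1 + t₀ ^ 6) * (k * t₀)) / 3 / s ^ 6 := by
  have ht0 : 0 ≤ t₀ := ht.trans htt
  have hs6 : 0 < s ^ 6 := pow_pos hs 6
  rw [div_div, le_div_iff₀ (by positivity)]
  have e : (32768 * c ^ 6 / (3 * s ^ 6) * m + 32768 * t₀ ^ 5 * c ^ 6 / (3 * s ^ 6) * (m * t) +
      1048576 * γ ^ 6 * t₀ ^ 5 * (1 + t₀ ^ 6) / (3 * s ^ 6) * (k * t)) * (3 * s ^ 6) =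
      32768 * c ^ 6 * m + 32768 * t₀ ^ 5 * c ^ 6 * (m * t) + 1048576 * γ ^ 6 * t₀ ^ 5 * (1 + t₀ ^ 6) * (k * t) := by
    field_simp
  rw [e]
  have h1 : m * t ≤ m * t₀ := mul_le_mul_of_nonneg_left htt hm
  have h2 : k * t ≤ k * t₀ := mul_le_mul_of_nonneg_left htt hk
  have hk2 : 0 ≤ 32768 * t₀ ^ 5 * c ^ 6 := mul_nonneg (mul_nonneg (by norm_num) (pow_nonneg ht0 5)) (by positivity)
  have hk3 : 0 ≤ 1048576 * γ ^ 6 * t₀ ^ 5 * (1 + t₀ ^ 6) :=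
    mul_nonneg (mul_nonneg (by positivity) (pow_nonneg ht0 5)) (by positivity)
  nlinarith [mul_le_mul_of_nonneg_left h1 hk2, mul_le_mul_of_nonneg_left h2 hk3]

/-- `ofReal a · (ofReal b · X) = ofReal (a b) · X`. [folklore] -/
theorem ofReal_mul_ofReal_mul (X : ℝ≥0∞) {a b : ℝ} (ha : 0 ≤ a) :
    ENNReal.ofReal a * (ENNReal.ofReal b * X) = ENNReal.ofReal (a * b) * X := by
  rw [ENNReal.ofReal_mul ha, mul_assoc]

/-- `ofReal a · (ofReal b · X · ofReal c) = ofReal (a (b c)) · X`. [folklore] -/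
theorem ofReal_mul_ofReal_mul_ofReal (X : ℝ≥0∞) {a b c : ℝ} (ha : 0 ≤ a) (hb : 0 ≤ b) :
    ENNReal.ofReal a * (ENNReal.ofReal b * X * ENNReal.ofReal c) = ENNReal.ofReal (a * (b * c)) * X := by
  rw [ENNReal.ofReal_mul ha, ENNReal.ofReal_mul hb]
  ring

/-- `ofReal p · X + ofReal q · X = ofReal (p + q) · X` for `p, q ≥ 0`. [folklore] -/
theorem ofReal_mul_add_ofReal_mul (X : ℝ≥0∞) {p q : ℝ} (hp : 0 ≤ p) (hq : 0 ≤ q) :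
    ENNReal.ofReal p * X + ENNReal.ofReal q * X = ENNReal.ofReal (p + q) * X := by
  rw [← add_mul, ← ENNReal.ofReal_add hp hq]

end Summit.AtomisticToContinuum.FouriersLaw.Theorems.OddCorrectorBathLocality

end
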